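import Summits.Ventures.PercRepro.C026
import Summits.Ventures.PercRepro.C026Pairing

/-!
# C-026: the class sum of `kernel26` is the count `#OnePair − #Bad₃` (p5, gen 7)

The bridge between the statement file (`C026.lean`: `kernel26`, `cubeSumQuad`, the antipodal
principle) and the combinatorial file (`C026Pairing.lean`: the cut tree `δ`, `Bad₃`, `Bot₃`):

* `rowInd3_eq_ite` — a row indicator is the indicator of the engine's partition row;
  **`kernel26_eq_ite`** — on an antipodal pair `(ρ, ρᶜ)` the kernel is
  `[ρ one pair] − [a ~_ρ b ∧ c iso in ρᶜ]`;
* **`cubeSumQuad_kernel26_eq`** — the full-cube class sum is `#OnePair − #{a ~_S b ∧ c iso in S̄}`;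
  with the pairing, **`cubeSumQuad_kernel26_nonneg_iff`**: the class sum is nonnegative iff
  `#Bot₃ ≤ #(ac|b) + #(bc|a)`;
* **`Bot3BoundSimpleUpTo N`** — that residual bound on every simple graph with ≤ N vertices and three
  distinct marks — and **`C026UpTo_of_bot3Bound`**: it gives C-026 at every `p` on every multigraph
  with ≤ N vertices.  The pass scheme of `C026Pass.lean` produces the injection behind the bound.
-/

namespace PercRepro

open Finset

namespace MultiGraph

variable {V E : Type*} (G : MultiGraph V E) [Fintype E] [DecidableEq E]

omit [Fintype E] [DecidableEq E] in
open Classical in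
/-- A row indicator is the indicator of the engine's partition row. -/
theorem rowInd3_eq_ite (m : Fin 3 → V) (ω : Config E) (s : Fin 5) :
    rowInd3 s (G.markedPartition ω m) = if ω ∈ G.partitionEvent m (rgs3 s) then 1 else 0 := by
  unfold rowInd3
  rw [G.partitionEvent_eq_partitionSetoidEvent]
  rfl

omit [Fintype E] [DecidableEq E] in
/-- The five rows are exhaustive and exclusive: a configuration is in exactly one of
`abc`, `ab|c`, `ac|b`, `bc|a`, `a|b|c`. -/
theorem rows3_cases (a b c : V) (ω : Config E) :
    (G.Conn ω a b ∧ G.Conn ω a c ∧ G.Conn ω b c) ∨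
      (G.Conn ω a b ∧ ¬ G.Conn ω a c ∧ ¬ G.Conn ω b c) ∨
        (¬ G.Conn ω a b ∧ G.Conn ω a c ∧ ¬ G.Conn ω b c) ∨
          (¬ G.Conn ω a b ∧ ¬ G.Conn ω a c ∧ G.Conn ω b c) ∨
            (¬ G.Conn ω a b ∧ ¬ G.Conn ω a c ∧ ¬ G.Conn ω b c) := by
  obtain ⟨h1, h2, h3⟩ := G.conn_three_trans a b c (ω := ω)
  tauto

omit [Fintype E] [DecidableEq E] in
open Classical in
/-- **The kernel on an antipodal pair**: `kernel26(Π(ρ), Π(ρᶜ)) = [ρ one pair] − [a ~_ρ b ∧ c iso in ρᶜ]`. -/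
theorem kernel26_eq_ite (a b c : V) (ρ : Config E) :
    kernel26 (G.markedPartition ρ ![a, b, c]) (G.markedPartition ρᶜ ![a, b, c]) =
      (if G.OnePair ρ a b c then 1 else 0) -
        (if G.Conn ρ a b ∧ G.IsCIso ρᶜ a b c then 1 else 0) := by
  unfold kernel26
  simp only [G.rowInd3_eq_ite]
  have e0 := G.partitionEvent_row_abc a b c
  have e1 := G.partitionEvent_row_ab_c a b c
  have e2 := G.partitionEvent_row_ac_b a b c
  have e3 := G.partitionEvent_row_bc_a a b c
  have e4 := G.partitionEvent_row_a_b_c a b c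
  simp only [show rgs3 0 = ![0, 0, 0] from rfl, show rgs3 1 = ![0, 0, 1] from rfl,
    show rgs3 2 = ![0, 1, 0] from rfl, show rgs3 3 = ![0, 1, 1] from rfl,
    show rgs3 4 = ![0, 1, 2] from rfl, e0, e1, e2, e3, e4, Set.mem_inter_iff, mem_connEvent,
    mem_sepEvent, OnePair, IsCIso]
  rcases G.rows3_cases a b c ρ with ⟨hab, hac, hbc⟩ | ⟨hab, hac, hbc⟩ | ⟨hab, hac, hbc⟩ |
      ⟨hab, hac, hbc⟩ | ⟨hab, hac, hbc⟩ <;>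
    rcases G.rows3_cases a b c ρᶜ with ⟨hab', hac', hbc'⟩ | ⟨hab', hac', hbc'⟩ |
      ⟨hab', hac', hbc'⟩ | ⟨hab', hac', hbc'⟩ | ⟨hab', hac', hbc'⟩ <;>
    simp [hab, hac, hbc, hab', hac', hbc']

open Classical in
/-- **The class sum of `kernel26` is the count** `#OnePair − #{S : a ~_S b ∧ c iso in S̄}`. -/
theorem cubeSumQuad_kernel26_eq (a b c : V) :
    G.cubeSumQuad ![a, b, c] kernel26 =
      ((Finset.univ.filter fun ω : Config E => G.OnePair ω a b c).card : ℝ) -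
        ((Finset.univ.filter fun ω : Config E => G.Conn ω a b ∧ G.IsCIso ωᶜ a b c).card : ℝ) := by
  unfold cubeSumQuad cubeSum
  simp only [G.kernel26_eq_ite, Finset.sum_sub_distrib, Finset.sum_boole]

open Classical in
/-- **The class lemma of C-026 in residual form**: the class sum is nonnegative iff
`#Bot₃ ≤ #(ac|b) + #(bc|a)`. -/
theorem cubeSumQuad_kernel26_nonneg_iff (a b c : V) :
    0 ≤ G.cubeSumQuad ![a, b, c] kernel26 ↔
      (Finset.univ.filter fun ω : Config E => G.Bot3 ω a b c).card ≤
        (Finset.univ.filter fun ω : Config E => G.Conn ω a c ∧ ¬ G.Conn ω a b).card +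
          (Finset.univ.filter fun ω : Config E => G.Conn ω b c ∧ ¬ G.Conn ω a b).card := by
  rw [G.cubeSumQuad_kernel26_eq, sub_nonneg, Nat.cast_le, G.card_conn_cIso_compl_eq_card_bad3,
    G.card_bad3_le_iff]

end MultiGraph

open Classical in
/-- **The residual bound on the simple graphs with ≤ N vertices and three distinct marks**:
`#Bot₃ ≤ #(ac|b) + #(bc|a)` — the content of C-026's class lemma (mine-3's pass scheme is an
explicit injection `Bot₃ ↪ ac|b ⊔ bc|a`). -/
def Bot3BoundSimpleUpTo (N : ℕ) : Prop :=
  ∀ {V E : Type} [Fintype V] [Fintype E] [DecidableEq E], Fintype.card V ≤ N →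
    ∀ (G : MultiGraph V E), G.IsSimple → ∀ a b c : V, a ≠ b → a ≠ c → b ≠ c →
      (Finset.univ.filter fun ω : Config E => G.Bot3 ω a b c).card ≤
        (Finset.univ.filter fun ω : Config E => G.Conn ω a c ∧ ¬ G.Conn ω a b).card +
          (Finset.univ.filter fun ω : Config E => G.Conn ω b c ∧ ¬ G.Conn ω a b).card

/-- **C-026 on ≤ N vertices from the residual bound on the simple graphs with ≤ N vertices.** -/
theorem C026UpTo_of_bot3Bound {N : ℕ} (h : Bot3BoundSimpleUpTo N) : C026UpTo N := by
  refine C026UpTo_of_simpleInj ?_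
  intro V E _ _ _ hV G hs m hm
  have hm' : m = ![m 0, m 1, m 2] := by
    funext i
    fin_cases i <;> rfl
  rw [hm', G.cubeSumQuad_kernel26_nonneg_iff]
  exact h hV G hs (m 0) (m 1) (m 2) (fun h01 => absurd (hm h01) (by decide))
    (fun h02 => absurd (hm h02) (by decide)) (fun h12 => absurd (hm h12) (by decide))

end PercRepro
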